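import Literature.Analysis.FunctionSpaces.TorusImprovedHolder
import HarnessLib

/-!
# The improved Hölder inequality at `p = 1`, two-sided:
# `|∫ f g - (∫ f)(∫ g)| ≤ (L√d/N) ∫ g` for a `(1/N)ℤ^d`-invariant weight `g ≥ 0`

Analysis/FunctionSpaces support file (all results proved; no definitions, no named facts),
continuing `TorusImprovedHolder`, which proves the UPPER improved Hölder inequality of
Modena–Székelyhidi (Ann. PDE 4 (2018), Lemma 2.1: `| ‖fg_λ‖_p - ‖f‖_p‖g‖_p | ≤ C_p λ^{-1/p}‖f‖_{C¹}‖g‖_p`,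
upper half only, `Torus.lintegral_rpow_smul_le_of_latticeInvariant`). At the endpoint `p = 1` the
inequality is LINEAR in `f`, and the two-sided (decorrelation) form follows from the upper one by
applying it to the two non-negative functions `B + f` and `B - f`, which have the same Lipschitz
constant as `f` (the constant `B` cancels):

* `Torus.integral_mul_le_of_latticeInvariant` — the upper inequality at `p = 1` in real form:
  for `f ≥ 0` continuous with `L`-Lipschitz lift and an integrable `(1/N)ℤ^d`-invariant weight
  `g ≥ 0`, `∫ f g ≤ (∫ f + L √d / N) ∫ g`;
* `Torus.abs_integral_mul_sub_le_of_latticeInvariant` — **the two-sided form**: for `|f| ≤ B` with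
  `L`-Lipschitz lift and `g` as above, `|∫ f g - (∫ f)(∫ g)| ≤ (L √d / N) ∫ g`;
* `Torus.le_integral_mul_of_latticeInvariant` — the lower half alone.

Use (first consumer): the normalising constants `A_{j,k} = ⨍ φ̃_j²(M_k x) sin²(N_k(x - x_j)·η_j) dx ∼ δ`
of the Mikado data of Coiculescu–Palasek (Invent. Math. 244 (2025), Lemma 3.2 (4): "an easy
application of [the improved Hölder inequality], using `⨍ φ̃_j² ∼ δ` and that `N_k/M_k` can be made
larger than any absolute constant") need BOTH bounds, `A_{j,k}` entering Def. 3.5 through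
`A_{j,k}^{-1/2}`.

## References

* S. Modena, L. Székelyhidi Jr., Ann. PDE 4 (2018), no. 18 = arXiv:1712.03867, §2.1 Lemma 2.1.
  [`ModenaSzekelyhidi2018`]
* M. P. Coiculescu, S. Palasek, Invent. Math. 244 (2025) 165–219, arXiv:2503.14699, Lemma 3.2 (4),
  App. A Lemma A.2. [`CoiculescuPalasek2025`]
-/

noncomputable section

open MeasureTheory Set Filter Function

namespace Literature.Analysis.FunctionSpaces

namespace Torus

variable {d : Type*} [Fintype d] [DecidableEq d]

/-- For a non-negative integrable real function, `∫⁻ ‖h‖ₑ = ofReal (∫ h)`. [folklore] -/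
private theorem lintegral_enorm_eq_ofReal_integral' {X : Type*} [MeasurableSpace X]
    {μ : Measure X} {h : X → ℝ} (hint : Integrable h μ) (h0 : ∀ x, 0 ≤ h x) :
    ∫⁻ x, ‖h x‖ₑ ∂μ = ENNReal.ofReal (∫ x, h x ∂μ) := by
  rw [ofReal_integral_eq_lintegral_ofReal hint (Eventually.of_forall h0)]
  exact lintegral_congr fun x => Real.enorm_eq_ofReal (h0 x)

variable {N : ℕ} {L B : ℝ} {f g : UnitAddTorus d → ℝ}

/-- **The improved Hölder inequality at `p = 1`, real form.** For `f ≥ 0` with `L`-Lipschitz lift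
and an integrable `(1/N)ℤ^d`-invariant weight `g ≥ 0`:
`∫ f g ≤ (∫ f + L √d / N) · ∫ g` (Modena–Székelyhidi 2018, Lemma 2.1 at `p = 1`, upper half;
the `lintegral` statement `Torus.lintegral_rpow_smul_le_of_latticeInvariant` read in `ℝ`).
[cite: ModenaSzekelyhidi2018, §2.1 Lemma 2.1] -/
theorem integral_mul_le_of_latticeInvariant (hN : 0 < N) (hL : 0 ≤ L) (hf0 : ∀ x, 0 ≤ f x)
    {M : ℝ} (hfM : ∀ x, |f x| ≤ M)
    (hfL : ∀ y y' : EuclideanSpace ℝ d, |f (proj y) - f (proj y')| ≤ L * ‖y - y'‖)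
    (hg0 : ∀ x, 0 ≤ g x) (hgi : Integrable g volume)
    (hper : ∀ (x : UnitAddTorus d) (κ : d → Fin N), g (x + proj (cellCorner N κ)) = g x) :
    ∫ x, f x * g x ≤ ((∫ x, f x) + L * (Real.sqrt (Fintype.card d) / N)) * ∫ x, g x := by
  have hfc : Continuous f := continuous_of_lipschitz_lift hL hfL
  have hfi : Integrable f volume :=
    hfc.integrable_of_hasCompactSupport (HasCompactSupport.of_compactSpace _)
  have hfgi : Integrable (fun x => f x * g x) volume :=
    hgi.bdd_mul hfc.aestronglyMeasurable (Eventually.of_forall fun x => by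
      rw [Real.norm_eq_abs]; exact hfM x)
  have hIH := lintegral_rpow_smul_le_of_latticeInvariant (d := d) (N := N) (p := 1) (M := M)
    (L := L) (f := f) (g := g) hN le_rfl hL hfM hfL hgi.aestronglyMeasurable hper
  simp only [ENNReal.rpow_one, smul_eq_mul, sub_self, Real.rpow_zero, mul_one, one_mul] at hIH
  rw [lintegral_enorm_eq_ofReal_integral' hfgi (fun x => mul_nonneg (hf0 x) (hg0 x)),
    lintegral_enorm_eq_ofReal_integral' hfi hf0,
    lintegral_enorm_eq_ofReal_integral' hgi hg0] at hIH
  have hIf : 0 ≤ ∫ x, f x := integral_nonneg hf0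
  have hIg : 0 ≤ ∫ x, g x := integral_nonneg hg0
  have hC0 : 0 ≤ L * (Real.sqrt (Fintype.card d) / N) := by positivity
  rwa [← ENNReal.ofReal_add hIf hC0, ← ENNReal.ofReal_mul (add_nonneg hIf hC0),
    ENNReal.ofReal_le_ofReal_iff (mul_nonneg (add_nonneg hIf hC0) hIg)] at hIH

/-- **Decorrelation, upper half**: for `|f| ≤ B` with `L`-Lipschitz lift and an integrable
`(1/N)ℤ^d`-invariant weight `g ≥ 0`, `∫ f g ≤ (∫ f)(∫ g) + (L √d / N) ∫ g` (apply the improved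
Hölder inequality at `p = 1` to `B + f ≥ 0`; the constant `B` cancels).
[cite: ModenaSzekelyhidi2018, §2.1 Lemma 2.1] -/
theorem integral_mul_le_integral_mul_integral_add_of_latticeInvariant (hN : 0 < N) (hL : 0 ≤ L)
    (hfB : ∀ x, |f x| ≤ B)
    (hfL : ∀ y y' : EuclideanSpace ℝ d, |f (proj y) - f (proj y')| ≤ L * ‖y - y'‖)
    (hg0 : ∀ x, 0 ≤ g x) (hgi : Integrable g volume)
    (hper : ∀ (x : UnitAddTorus d) (κ : d → Fin N), g (x + proj (cellCorner N κ)) = g x) :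
    ∫ x, f x * g x ≤ (∫ x, f x) * (∫ x, g x) + L * (Real.sqrt (Fintype.card d) / N) * ∫ x, g x := by
  have hB : 0 ≤ B := (abs_nonneg _).trans (hfB 0)
  have hfc : Continuous f := continuous_of_lipschitz_lift hL hfL
  have hfi : Integrable f volume :=
    hfc.integrable_of_hasCompactSupport (HasCompactSupport.of_compactSpace _)
  have hfgi : Integrable (fun x => f x * g x) volume :=
    hgi.bdd_mul hfc.aestronglyMeasurable (Eventually.of_forall fun x => by
      rw [Real.norm_eq_abs]; exact hfB x)
  -- the shifted function `B + f ≥ 0`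
  have h := integral_mul_le_of_latticeInvariant (f := fun x => B + f x) (g := g) hN hL
    (fun x => by linarith [neg_abs_le (f x), hfB x]) (M := 2 * B)
    (fun x => by
      have h1 := hfB x
      rw [abs_le] at h1 ⊢
      constructor <;> linarith)
    (fun y y' => by
      have : B + f (proj y) - (B + f (proj y')) = f (proj y) - f (proj y') := by ring
      rw [this]; exact hfL y y')
    hg0 hgi hper
  have e1 : ∫ x, (B + f x) * g x = B * (∫ x, g x) + ∫ x, f x * g x := by
    have : (fun x => (B + f x) * g x) = fun x => B * g x + f x * g x := by
      funext x; ring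
    rw [this, integral_add (hgi.const_mul B) hfgi, integral_const_mul]
  have e2 : ∫ x, (B + f x) = B + ∫ x, f x := by
    rw [integral_add (integrable_const B) hfi, integral_const]
    simp
  rw [e1, e2] at h
  nlinarith [h]

/-- **Decorrelation, lower half**: under the same hypotheses,
`(∫ f)(∫ g) - (L √d / N) ∫ g ≤ ∫ f g` (the improved Hölder inequality at `p = 1` applied to `B - f ≥ 0`).
[cite: ModenaSzekelyhidi2018, §2.1 Lemma 2.1] -/
theorem le_integral_mul_of_latticeInvariant (hN : 0 < N) (hL : 0 ≤ L) (hfB : ∀ x, |f x| ≤ B)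
    (hfL : ∀ y y' : EuclideanSpace ℝ d, |f (proj y) - f (proj y')| ≤ L * ‖y - y'‖)
    (hg0 : ∀ x, 0 ≤ g x) (hgi : Integrable g volume)
    (hper : ∀ (x : UnitAddTorus d) (κ : d → Fin N), g (x + proj (cellCorner N κ)) = g x) :
    (∫ x, f x) * (∫ x, g x) - L * (Real.sqrt (Fintype.card d) / N) * ∫ x, g x ≤ ∫ x, f x * g x := by
  have h := integral_mul_le_integral_mul_integral_add_of_latticeInvariant (f := fun x => -f x)
    (g := g) hN hL (B := B) (fun x => by rw [abs_neg]; exact hfB x)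
    (fun y y' => by
      have : -f (proj y) - -f (proj y') = -(f (proj y) - f (proj y')) := by ring
      rw [this, abs_neg]; exact hfL y y')
    hg0 hgi hper
  have e1 : ∫ x, -f x * g x = -∫ x, f x * g x := by
    have : (fun x => -f x * g x) = fun x => -(f x * g x) := by funext x; ring
    rw [this, integral_neg]
  rw [e1, integral_neg] at h
  linarith

/-- **The improved Hölder inequality at `p = 1`, two-sided (decorrelation).** For a real `f` on
`T^d` with `|f| ≤ B` and `L`-Lipschitz lift, and an integrable weight `g ≥ 0` invariant under the
lattice `(1/N)ℤ^d`:
`|∫ f g - (∫ f)(∫ g)| ≤ (L √d / N) · ∫ g`.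
This is Modena–Székelyhidi's Lemma 2.1 at the endpoint `p = 1`, where it is linear in `f` and the
lower half comes for free from the upper one. [cite: ModenaSzekelyhidi2018, §2.1 Lemma 2.1] -/
theorem abs_integral_mul_sub_le_of_latticeInvariant (hN : 0 < N) (hL : 0 ≤ L)
    (hfB : ∀ x, |f x| ≤ B)
    (hfL : ∀ y y' : EuclideanSpace ℝ d, |f (proj y) - f (proj y')| ≤ L * ‖y - y'‖)
    (hg0 : ∀ x, 0 ≤ g x) (hgi : Integrable g volume)
    (hper : ∀ (x : UnitAddTorus d) (κ : d → Fin N), g (x + proj (cellCorner N κ)) = g x) :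
    |(∫ x, f x * g x) - (∫ x, f x) * (∫ x, g x)| ≤ L * (Real.sqrt (Fintype.card d) / N) * ∫ x, g x := by
  have h1 : (∫ x, f x) * (∫ x, g x) - L * (Real.sqrt (Fintype.card d) / N) * (∫ x, g x) ≤
      ∫ x, f x * g x := le_integral_mul_of_latticeInvariant hN hL hfB hfL hg0 hgi hper
  have h2 : ∫ x, f x * g x ≤
      (∫ x, f x) * (∫ x, g x) + L * (Real.sqrt (Fintype.card d) / N) * (∫ x, g x) :=
    integral_mul_le_integral_mul_integral_add_of_latticeInvariant hN hL hfB hfL hg0 hgi hper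
  rw [abs_le]
  exact ⟨by linarith, by linarith⟩

end Torus

end Literature.Analysis.FunctionSpaces
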